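import Literature.MathematicalPhysics.QuantumFieldTheory.Balaban1983to89.T4CubeChartExp
import Literature.MathematicalPhysics.QuantumFieldTheory.Balaban1983to89.T4QuatExpLog

/-!
# `T4Continuum.ShellMeasureExpChartDictionary` — the exponential `SU(2)` chart of the cell IS the matrix exponential of
# a skew-Hermitian matrix: `expPoint x = exp (quatMatrix (ι x))` in `M₂(ℂ)`
# (cell `pub-balaban`, sub-cell `t4`, spine estimate NE7c (node U5b); lineage t4-ne7c-p1 = PROVER seat P1
# «shell-measure route», generation 25; the dictionary step (0-a) of record `t4/T4-EST-NE7c-P1.md` v3.13 §5;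
# ADDITIVE — imports the tree's `T4CubeChartExp` and `T4QuatExpLog` (which already proves `quatMatrix_exp`) only)

HONEST FRAMING.  [folklore] kernel dictionary between two tree objects — the quaternionic one-bond chart
`T4HaarSU2ExpChart.expPoint x = quatToSU2 (exp (ι x))` (used by `T4CubeChartExp.expFibreChart`, by the realized
headlines of `ShellMeasureScalingSU2` ∕ `ShellMeasureHeadlines`) and Mathlib's `NormedSpace.exp` on `M₂(ℂ)` (used by the
level-0 instance `ShellMeasureWilson{Words,Trace,Block}`): `quatMatrix` intertwines the exponentials (the tree's
`T4QuatExpLog.quatMatrix_exp`, from Mathlib `NormedSpace.map_exp`), whence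
`(expPoint x : M₂(ℂ)) = exp (quatMatrix (ι x))` with `quatMatrix (ι x)` skew-Hermitian.  CONSEQUENCE: in the cell's
`SU(2)` exponential fibre chart every chart bond IS a word letter `exp Y_b(x)` with `Y_b` real-linear in the chart
point and skew-Hermitian — the hypotheses `hLu`∕`hLw`∕`hgood` of `ShellMeasureWilsonBlock.slotAntiConcentration_levelZero`
are of the realized chart's shape (the full realized assembly on `(fieldMeasure P 0 SU2).withDensity F` is NOT done
here).  Nothing of [Balaban 1983–89] is asserted; rung (B)+1 finite T⁴ — NOT infinite volume, NOT mass gap, NOT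
Clay; NE7c NOT proved; 0 sorry, 0 citations.
-/

noncomputable section

open NormedSpace
open scoped Quaternion

namespace Summit.QuantumFields.BalabanUV.T4Continuum.ShellMeasureExpChartDictionary

open Literature.MathematicalPhysics.QuantumLattice
open Literature.MathematicalPhysics.QuantumFieldTheory.Balaban1983to89
open T4HaarSU2ExpChart (imQuat expPoint su2Quat_expPoint)

section Exp

open scoped Matrix.Norms.L2Operator
open T4QuatExpLog (quatMatrix_exp)

/-- **THE DICTIONARY**: the exponential chart point of `T4HaarSU2ExpChart` (a point of `SU(2)` as a matrix) IS the
matrix exponential of the skew-Hermitian matrix `quatMatrix (ι x)`: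
`(expPoint x : M₂(ℂ)) = exp (quatMatrix (imQuat x))`. [folklore] -/
theorem coe_expPoint_eq_exp (x : EuclideanSpace ℝ (Fin 3)) :
    ((expPoint x : Matrix.specialUnitaryGroup (Fin 2) ℂ) : Matrix (Fin 2) (Fin 2) ℂ) =
      exp (quatMatrix (imQuat x)) := by
  rw [← quatMatrix_su2Quat (expPoint x), su2Quat_expPoint, quatMatrix_exp]

/-- the generator is SKEW-HERMITIAN: `quatMatrix (ι x) ∈ skewAdjoint M₂(ℂ)` (so `Re Tr = 0` and its exponentials are
unitary — the admissibility `ShellMeasureWilsonBlock.good_gen_of_mem_skewAdjoint`). [folklore] -/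
theorem quatMatrix_imQuat_mem_skewAdjoint (x : EuclideanSpace ℝ (Fin 3)) :
    quatMatrix (imQuat x) ∈ skewAdjoint (Matrix (Fin 2) (Fin 2) ℂ) := by
  rw [skewAdjoint.mem_iff, Matrix.star_eq_conjTranspose]
  ext i j
  fin_cases i <;> fin_cases j <;> apply Complex.ext <;> simp [quatMatrix, imQuat, Matrix.conjTranspose_apply]

/-- the generator is REAL-LINEAR in the chart point: `quatMatrix (ι (c • x)) = (c : ℂ) • quatMatrix (ι x)` — the
ray-linearity `hLu` of the level-0 instance for the cell's exponential chart. [folklore] -/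
theorem quatMatrix_imQuat_smul (c : ℝ) (x : EuclideanSpace ℝ (Fin 3)) :
    quatMatrix (imQuat (c • x)) = (c : ℂ) • quatMatrix (imQuat x) := by
  rw [map_smul, quatMatrix_smul]

/-- CONSEQUENCE for the one-bond chart of `T4CubeChartExp`: `expPt v = exp (quatMatrix (ι (toE v)))` as matrices, and
the scaled chart point is the scaled generator: `expPt (c • v) = exp ((c : ℂ) • quatMatrix (ι (toE v)))`. [folklore] -/
theorem coe_expPt_smul (c : ℝ) (v : Fin 3 → ℝ) :
    ((T4CubeChartExp.expPt (c • v) : Matrix.specialUnitaryGroup (Fin 2) ℂ) : Matrix (Fin 2) (Fin 2) ℂ) =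
      exp ((c : ℂ) • quatMatrix (imQuat (T4CubeChartExp.toE v))) := by
  rw [T4CubeChartExp.expPt, coe_expPoint_eq_exp, ← quatMatrix_imQuat_smul]
  congr 2

end Exp

end Summit.QuantumFields.BalabanUV.T4Continuum.ShellMeasureExpChartDictionary
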